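import Literature.NumberTheory.EllipticCurves.ComplexMultiplicationDeuringReductionCMEndProofs
import Literature.NumberTheory.EllipticCurves.FrobeniusTateModuleTraceProofs
import Literature.NumberTheory.EllipticCurves.SupersingularDensity
import Literature.NumberTheory.EllipticCurves.OrdinaryPrimesProofs
import Mathlib.RingTheory.Polynomial.RationalRoot
import Mathlib.NumberTheory.LegendreSymbol.JacobiSymbol
import HarnessLib

/-!
# Deuring's criterion for the supersingular primes of a CM curve over `ℚ`, from the reduction of
# endomorphisms

Topic `NumberTheory/EllipticCurves`. A *proofs* file (D-0014 append protocol: nothing is asserted,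
every declaration is a theorem) serving the named fact
`WeierstrassCurve.deuring_supersingular_density_half` of
`Literature.NumberTheory.EllipticCurves.SupersingularDensity` (Deuring 1941: for `E/ℚ` with complex
multiplication the supersingular primes have natural density `1/2`). It proves the **algebraic
half** of that statement — Deuring's criterion — conditionally on the one deep input the tree has
not discharged, the reduction of endomorphisms modulo a good prime (the named fact
`Literature.NumberTheory.EllipticCurves.Silverman1994_exists_reduction_ringHom_geomEndRing`,
Silverman, *Advanced Topics*, Prop. II.4.4; itself a theorem of the tree from the existence of the
reduction map, `Lang1987_exists_reduction_geomPoints_geomEndRing`,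
`ComplexMultiplicationDeuringReductionMapProofs`):

* `Literature.NumberTheory.EllipticCurves.exists_forall_mem_goodSupersingularPrimes_iff_of_reduction`
  — given that fact, for every elliptic curve `E/ℚ` (globally minimal `W`) with (geometric) complex
  multiplication there is an integer `D < 0` (the discriminant `t² - 4n` of a CM endomorphism
  `φ`, `φ² - tφ + n = 0`, so that `ℚ(√D)` is the CM field) such that for all primes `p ∤ 2DΔ_W`:
  `p` is a good supersingular prime of `W` (`p ∣ a_p`) iff `(D/p) = -1` (`p` is inert in the CM
  field).

This is Lang, *Elliptic Functions*, Ch. 13 §4, Thm. 12 (first assertion; Deuring 1941): *"The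
curve `Ā` is supersingular if and only if `p` has only one prime of `k` above it"*, for the primes
`p ∤ 2DΔ` (which excludes the finitely many ramified and bad primes), with "supersingular" in
Lang's sense (`Ā_p = 0`, Ch. 13, PDF p. 130) translated into `p ∣ a_p` (Silverman, *AEC*,
Ex. V.5.10(a)) by the theorems of §1.

## Contents (all proved)

§1 **Supersingular `⇔ p ∣ a`** for an elliptic curve `E` over a finite field `k` of characteristic
`p`, `a = #k + 1 - #E(k)` the trace of the Frobenius `π` (`π² - aπ + #k = 0`, the tree's
`frobeniusIsogeny_comp_sub_smul_add_smul_id_eq_zero`, Manin's proof of *AEC* V.2.3.1(b)):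
* `WeierstrassCurve.forall_nsmul_ne_zero_of_dvd_trace`: `p ∣ a ⇒ E(k̄)[p] = 0` (`π` is injective);
* `WeierstrassCurve.dvd_trace_of_forall_nsmul_ne_zero`: `E(k̄)[p] = 0 ⇒ p ∣ a` (both `π` and
  `[a] - π` — which satisfies `([a] - π) ∘ π = [#k]` — then have trivial kernel, so factor through
  the same Frobenius `F : E → E^{(q)}` by *AEC* Cor. II.2.12 (the tree's
  `Isogeny.exists_eq_comp_frobeniusTwistIsogeny`), whence `[a] = μ ∘ F` and `p ∣ deg [a] = a²`).

§2 **Deuring's criterion downstairs**: for `E` over `𝔽_p` (`p` odd) carrying a geometric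
endomorphism `ψ` with `ψ² = D`, `D < 0`, `p ∤ D`:
* `WeierstrassCurve.exists_ne_zero_nsmul_eq_zero_of_sq_eq` — `(D/p) = 1 ⇒ E[p] ≠ 0` (the tree's
  `Isogeny.exists_ne_zero_nsmul_eq_zero_of_comp_self_eq_smul`, Lang's proof of Thm. 12);
* `WeierstrassCurve.isSquare_of_exists_nsmul_eq_zero_of_not_dvd_trace` — `E[p] ≠ 0`, `p ∤ a ⇒
  (D/p) = 1`: `End_{𝔽̄_p}(E)` embeds in the integers of an imaginary quadratic field `K'` (Deuring;
  Lang Ch. 13 §2 Thm. 5(i), the tree's theorem `Lang1987_geomEndRing_isOrder_of_exists_pTorsion_holds`),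
  where `ψ ↦ √D` and `π ↦ (a + w√D)/2` with `w ∈ ℚ`, `w² D = a² - 4p`, so `D` is a square mod `p`;
* `WeierstrassCurve.natCast_dvd_trace_iff_not_isSquare` — hence `p ∣ a ⇔ (D/p) = -1`.

§3 **Upstairs**: `exists_sq_eq_intCast_of_hasCM` (`HasCM ⇒ ψ ∈ End_{ℚ̄}(E)`, `ψ² = D < 0`, from
the tree's `exists_int_quadratic_of_mem_geomEndRing`, *AEC* Cor. III.6.3), the reduction `r(ψ)`
of `ψ` (`r` the ring homomorphism of the named fact), `frobeniusTrace W p = p + 1 - #Ē(𝔽_p)`, and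
the assembly `exists_forall_mem_goodSupersingularPrimes_iff_of_reduction`.

## References

* [Lang1987] S. Lang, *Elliptic Functions*, 2nd ed., GTM 112 (1987): Ch. 13 §4 Thm. 12 (PDF
  p. 140) and its proof (pp. 140–141); Ch. 13 §2 Thm. 4, Thm. 5(i) (PDF pp. 133–134); Ch. 13
  intro (PDF p. 130). Held: `book:lang1987-elliptic-functions`.
* [Deuring1941] M. Deuring, *Die Typen der Multiplikatorenringe elliptischer Funktionenkörper*,
  Abh. Math. Sem. Univ. Hamburg 14 (1941), 197–272.
* [SilvermanAEC2009] J. H. Silverman, *The Arithmetic of Elliptic Curves*, 2nd ed. (2009):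
  Cor. II.2.12, Thm. III.4.10, Cor. III.6.3, Thm. V.2.3.1, V.§3–4 and Ex. V.5.10(a).
* [SilvermanAdvancedTopics1994] J. H. Silverman, *Advanced Topics in the Arithmetic of Elliptic
  Curves*, GTM 151 (1994), Prop. II.4.4 (reduction of endomorphisms).
* [Serre1981] J.-P. Serre, *Quelques applications du théorème de densité de Chebotarev*, Publ.
  Math. IHÉS 54 (1981), §8 (the supersingular primes `a_p = 0`). Held:
  `paper:doi-10-1007-bf02698692`.

## Design

`noncomputable section`, `open scoped Classical`, one universe `u`; the finite-field theorems are
dot-notation extensions in `namespace WeierstrassCurve` (as in `DeuringSplitOrdinaryProofs`), the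
assembly over `ℚ` in `namespace Literature.NumberTheory.EllipticCurves`. Nothing is defined and no
named fact is introduced: the reduction of endomorphisms enters as the hypothesis
`(hR : Silverman1994_exists_reduction_ringHom_geomEndRing)` of the final theorems (D-0026).
-/

noncomputable section

open scoped Classical NumberTheorySymbols NumberField

universe u

namespace WeierstrassCurve

open Literature.NumberTheory.EllipticCurves

variable {K : Type u} [Field K]

/-! ## §1 Supersingular `⇔ p ∣ a` over a finite field -/

section Trace

variable [Finite K] (W : WeierstrassCurve K) [W.IsElliptic] (p : ℕ) [Fact p.Prime] [CharP K p]
  {σ : Field.absoluteGaloisGroup K}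

/-- The Frobenius relation pointwise: `σ(σ P) - a • σ P + q • P = 0` on `E(k̄)`, `q = #k`,
`a = q + 1 - #E(k)` (Silverman, *AEC*, Thm. V.2.3.1(b); the tree's
`frobeniusIsogeny_comp_sub_smul_add_smul_id_eq_zero`, Manin's proof). [cite: SilvermanAEC2009, Thm. V.2.3.1(b)] -/
theorem frobenius_frobenius_sub_trace_smul_add_card_smul
    (hσ : ∀ x : AlgebraicClosure K, σ • x = x ^ Nat.card K) (P : W.geomPoints) :
    σ • (σ • P) - ((Nat.card K : ℤ) + 1 - Nat.card W.toAffine.Point) • (σ • P) +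
      ((Nat.card K : ℕ) : ℤ) • P = 0 := by
  have h := congrArg (fun f : W.geomPoints →+ W.geomPoints ↦ f P)
    (frobeniusIsogeny_comp_sub_smul_add_smul_id_eq_zero W hσ)
  simpa using h

omit [Finite K] [W.IsElliptic] in
/-- `σ_q` commutes with multiplication by naturals on points. [folklore] -/
theorem frobenius_smul_nsmul (hσ : ∀ x : AlgebraicClosure K, σ • x = x ^ Nat.card K) (n : ℕ)
    (Q : W.geomPoints) : σ • (n • Q) = n • σ • Q := by
  simpa using map_nsmul (W.frobeniusIsogeny hσ) n Q

omit [Fact p.Prime] in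
/-- **`p ∣ a ⇒ E(k̄)` has no point of order `p`** (`E` supersingular in Lang's sense, *Elliptic
Functions*, Ch. 13, PDF p. 130). If `p ∣ a` and `p • P = 0` then `q • P = 0` and `a • σP = 0`, so
the Frobenius relation gives `σ(σ P) = 0`, whence `P = 0` (`σ` is injective on points).
Silverman, *AEC*, V.§3 (Thm. V.3.1(a)) and Ex. V.5.10(a). [cite: SilvermanAEC2009, Ex. V.5.10(a)] -/
theorem forall_nsmul_ne_zero_of_dvd_trace (hσ : ∀ x : AlgebraicClosure K, σ • x = x ^ Nat.card K)
    (ha : (p : ℤ) ∣ (Nat.card K : ℤ) + 1 - Nat.card W.toAffine.Point) :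
    ∀ P : W.geomPoints, P ≠ 0 → p • P ≠ 0 := by
  intro P hP0 hpP
  obtain ⟨a', ha'⟩ := ha
  obtain ⟨n, hn⟩ : ∃ n : ℕ, Nat.card K = p ^ n := by
    letI := Fintype.ofFinite K
    obtain ⟨n, _, hn⟩ := FiniteField.card K p
    exact ⟨n, by rw [Nat.card_eq_fintype_card, hn]⟩
  have hn0 : (n : ℕ) ≠ 0 := by
    intro h0
    letI := Fintype.ofFinite K
    rw [h0, pow_zero, Nat.card_eq_fintype_card] at hn
    exact Fintype.one_lt_card.ne' hn
  have hqP : ((Nat.card K : ℕ) : ℤ) • P = 0 := by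
    rw [natCast_zsmul, hn, ← Nat.succ_pred_eq_of_ne_zero hn0, pow_succ, mul_smul, hpP, smul_zero]
  have haP : ((Nat.card K : ℤ) + 1 - Nat.card W.toAffine.Point) • (σ • P) = 0 := by
    rw [ha', mul_comm, mul_smul, natCast_zsmul, ← W.frobenius_smul_nsmul hσ, hpP, smul_zero,
      smul_zero]
  have h := W.frobenius_frobenius_sub_trace_smul_add_card_smul hσ P
  rw [hqP, haP, sub_zero, add_zero] at h
  have hinj : ∀ Q : W.geomPoints, σ • Q = 0 → Q = 0 := fun Q hQ ↦ by
    rw [← inv_smul_smul σ Q, hQ, smul_zero]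
  exact hP0 (hinj P (hinj _ h))

/-- **`E(k̄)[p] = 0 ⇒ p ∣ a`** (a supersingular curve has trace of Frobenius `≡ 0 (mod p)`;
Silverman, *AEC*, Thm. V.3.1(a)(iii) and Ex. V.5.10(a), there via the Hasse invariant / the
invariant differential). Proof by degrees: the Frobenius `π` (degree `q = #k`, *AEC* II.2.11, the
tree's `frobeniusIsogeny_deg_eq_card_holds`) is injective on points, and so is `α = [a] - π`
(an isogeny of degree `q`, since `α ∘ π = [q]` by the Frobenius relation and `deg` is
multiplicative on `Hom_k(E, E)`, *AEC* Cor. III.6.3) when `E(k̄)[p] = 0`; by *AEC* Cor. II.2.12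
(the tree's `Isogeny.exists_eq_comp_frobeniusTwistIsogeny`) both factor through the `q`-power
Frobenius `F : E → E^{(q)}` with complementary factors of degree `1`, so `[a] = π + α = μ ∘ F` with
`μ ∈ Hom_k(E^{(q)}, E)`, and `a² = deg [a] = q · deg μ` (or `[a] = 0`): `p ∣ a`.
[cite: SilvermanAEC2009, Thm. V.3.1(a) and Ex. V.5.10(a)] [cite: Lang1987, Ch. 13 §4 Thm. 12 (proof, PDF pp. 140–141)] -/
theorem dvd_trace_of_forall_nsmul_ne_zero (hσ : ∀ x : AlgebraicClosure K, σ • x = x ^ Nat.card K)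
    (hnone : ∀ P : W.geomPoints, P ≠ 0 → p • P ≠ 0) :
    (p : ℤ) ∣ (Nat.card K : ℤ) + 1 - Nat.card W.toAffine.Point := by
  have hp : p.Prime := Fact.out
  haveI : ExpChar K p := ExpChar.prime hp
  have hpi : Prime (p : ℤ) := Nat.prime_iff_prime_int.mp hp
  set a : ℤ := (Nat.card K : ℤ) + 1 - Nat.card W.toAffine.Point with ha_def
  set q : ℕ := Nat.card K with hq_def
  have hq1 : 1 < q := by
    letI := Fintype.ofFinite K
    rw [hq_def, Nat.card_eq_fintype_card]
    exact Fintype.one_lt_card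
  have hq0 : ((q : ℕ) : ℤ) ≠ 0 := by exact_mod_cast (by omega : q ≠ 0)
  set π := W.frobeniusIsogeny hσ with hπ_def
  set f : W.geomPoints →+ W.geomPoints := π.toAddMonoidHom with hf_def
  set g := AddMonoidHom.id W.geomPoints with hg_def
  have h63 := degHom_isQuadraticForm_holds W W
  have hf : f ∈ homModule W W := π.toAddMonoidHom_mem_homModule
  have hg : g ∈ homModule W W := id_mem_homModule W
  have hfP : ∀ P, f P = σ • P := fun _ ↦ rfl
  have hsP : ∀ (n : ℤ) (φ : W.geomPoints →+ W.geomPoints) (P : W.geomPoints), (n • φ) P = n • φ P :=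
    fun _ _ _ ↦ rfl
  have hgP : ∀ P : W.geomPoints, g P = P := fun _ ↦ rfl
  -- the Frobenius relation `f ∘ f - a f + q = 0`, pointwise
  have hrel : f.comp f - a • f + ((q : ℕ) : ℤ) • g = 0 :=
    frobeniusIsogeny_comp_sub_smul_add_smul_id_eq_zero W hσ
  have hrelP : ∀ P, f (f P) = a • f P - ((q : ℕ) : ℤ) • P := fun P ↦ by
    have h := congrArg (fun φ : W.geomPoints →+ W.geomPoints ↦ φ P) hrel
    simp only [AddMonoidHom.add_apply, AddMonoidHom.sub_apply, AddMonoidHom.comp_apply,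
      AddMonoidHom.zero_apply, hsP, hgP] at h
    rw [← sub_eq_zero, ← h]
    abel
  -- `deg π = q` and `π` is injective
  have hdegf : degHom W W f = q := by
    rw [hf_def, degHom_toAddMonoidHom, hπ_def, W.frobeniusIsogeny_deg_eq_card_holds σ hσ]
  have hinj : ∀ Q : W.geomPoints, σ • Q = 0 → Q = 0 := fun Q hQ ↦ by
    rw [← inv_smul_smul σ Q, hQ, smul_zero]
  have hkerπ : Nat.card π.toAddMonoidHom.ker = 1 := by
    rw [Nat.card_eq_one_iff_unique]
    refine ⟨⟨fun x y ↦ Subtype.ext ?_⟩, ⟨0⟩⟩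
    have hx : σ • (x : W.geomPoints) = 0 := x.2
    have hy : σ • (y : W.geomPoints) = 0 := y.2
    rw [hinj _ hx, hinj _ hy]
  -- `α = a - π`, an isogeny of degree `q` with `α ∘ π = [q]`
  set αh : W.geomPoints →+ W.geomPoints := a • g - f with hαh_def
  have hαmem : αh ∈ homModule W W := sub_mem (Submodule.smul_mem _ _ hg) hf
  have hαhP : ∀ P, αh P = a • P - σ • P := fun P ↦ by
    rw [hαh_def, AddMonoidHom.sub_apply, hsP, hgP, hfP]
  have hαπ : αh.comp f = ((q : ℕ) : ℤ) • g := AddMonoidHom.ext fun P ↦ by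
    rw [AddMonoidHom.comp_apply, hαhP, hsP, hgP, ← hfP, hrelP]
    abel
  have hdegα : degHom W W αh = q := by
    have h1 : degHom W W (αh.comp f) = ((q : ℕ) : ℤ) ^ 2 := by
      rw [hαπ, degHom_zsmul h63 hg, degHom_id, mul_one]
    rw [degHom_comp hαmem hf, hdegf] at h1
    exact mul_right_cancel₀ hq0 (by rw [h1]; ring)
  obtain ⟨α, hα⟩ : ∃ α : Isogeny W W, α.toAddMonoidHom = αh := by
    rcases (mem_homModule_iff_holds W W αh).mp hαmem with h0 | h
    · exfalso
      rw [h0, degHom_zero] at hdegα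
      exact hq0 hdegα.symm
    · exact h
  have hαP : ∀ P, α P = a • P - σ • P := fun P ↦ by
    rw [← Isogeny.coe_toAddMonoidHom, hα, hαhP]
  have hαdeg : α.deg = q := by
    have : (α.deg : ℤ) = q := by rw [← degHom_toAddMonoidHom, hα, hdegα]
    exact_mod_cast this
  -- `α` is injective on points: `α (σ P) = q P` and `E(k̄)[p^∞] = 0`
  have hαπP : ∀ P, α (σ • P) = ((q : ℕ) : ℤ) • P := fun P ↦ by
    have h := congrArg (fun φ : W.geomPoints →+ W.geomPoints ↦ φ P) hαπ
    simp only [AddMonoidHom.comp_apply, hsP, hgP, hfP] at h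
    rw [← h, ← Isogeny.coe_toAddMonoidHom, hα]
  obtain ⟨n, hn⟩ : ∃ n : ℕ, q = p ^ n := by
    letI := Fintype.ofFinite K
    obtain ⟨n, _, hn⟩ := FiniteField.card K p
    exact ⟨n, by rw [hq_def, Nat.card_eq_fintype_card, hn]⟩
  have hpow : ∀ (m : ℕ) (P : W.geomPoints), p ^ m • P = 0 → P = 0 := by
    intro m
    induction m with
    | zero => intro P h; rwa [pow_zero, one_smul] at h
    | succ m ih =>
      intro P h
      rw [pow_succ, mul_smul] at h
      by_contra hP
      exact hnone P hP (ih _ h)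
  have hkerα : Nat.card α.toAddMonoidHom.ker = 1 := by
    rw [Nat.card_eq_one_iff_unique]
    have hx0 : ∀ z : α.toAddMonoidHom.ker, (z : W.geomPoints) = 0 := fun z ↦ by
      have hz : α (z : W.geomPoints) = 0 := z.2
      have hzP : (z : W.geomPoints) = σ • (σ⁻¹ • (z : W.geomPoints)) := (smul_inv_smul σ _).symm
      rw [hzP, hαπP, natCast_zsmul, hn] at hz
      rw [hzP, hpow n _ hz, smul_zero]
    exact ⟨⟨fun x y ↦ Subtype.ext (by rw [hx0 x, hx0 y])⟩, ⟨0⟩⟩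
  -- both `π` and `α` factor through the same Frobenius `F_r`
  obtain ⟨r, ι, -, hπcomp, hιdeg, -⟩ := π.exists_eq_comp_frobeniusTwistIsogeny p
  obtain ⟨r', lam, -, hαcomp, hlamdeg, -⟩ := α.exists_eq_comp_frobeniusTwistIsogeny p
  rw [hkerπ] at hιdeg
  rw [hkerα] at hlamdeg
  have hr : p ^ r = q := by
    have h := congrArg Isogeny.deg hπcomp
    rw [Isogeny.deg_comp, hιdeg, one_mul, deg_frobeniusTwistIsogeny] at h
    rw [← h, hπ_def]
    exact W.frobeniusIsogeny_deg_eq_card_holds σ hσ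
  have hr' : r = r' := by
    have h := congrArg Isogeny.deg hαcomp
    rw [Isogeny.deg_comp, hlamdeg, one_mul, deg_frobeniusTwistIsogeny, hαdeg, ← hr] at h
    exact Nat.pow_right_injective hp.two_le h
  subst hr'
  have hr0 : r ≠ 0 := by
    rintro rfl
    rw [pow_zero] at hr
    omega
  -- `[a] = (ι + λ) ∘ F`
  set F := W.frobeniusTwistIsogeny p r with hF
  have hsum : (ι.toAddMonoidHom + lam.toAddMonoidHom).comp F.toAddMonoidHom = a • g :=
    AddMonoidHom.ext fun P ↦ by
      have h1 : π P = ι (F P) := by rw [hπcomp, Isogeny.comp_apply]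
      have h2 : α P = lam (F P) := by rw [hαcomp, Isogeny.comp_apply]
      rw [AddMonoidHom.comp_apply, AddMonoidHom.add_apply, hsP, hgP, Isogeny.coe_toAddMonoidHom,
        Isogeny.coe_toAddMonoidHom, Isogeny.coe_toAddMonoidHom, ← h1, ← h2, hαP, hπ_def,
        frobeniusIsogeny_apply]
      abel
  have hmem : ι.toAddMonoidHom + lam.toAddMonoidHom ∈ homModule (W.frobeniusTwist p r) W :=
    add_mem ι.toAddMonoidHom_mem_homModule lam.toAddMonoidHom_mem_homModule
  have hdega : degHom W W (a • g) = a ^ 2 := by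
    rw [degHom_zsmul h63 hg, degHom_id, mul_one]
  rcases (mem_homModule_iff_holds (W.frobeniusTwist p r) W _).mp hmem with h0 | ⟨μ, hμ⟩
  · -- `ι + λ = 0` gives `[a] = 0`, so `a = 0`
    rw [h0, AddMonoidHom.zero_comp] at hsum
    have h1 := hdega
    rw [← hsum, degHom_zero] at h1
    have : a = 0 := pow_eq_zero_iff two_ne_zero |>.mp h1.symm
    rw [this]
    exact dvd_zero _
  · -- `a² = deg μ · p ^ r`
    have hcomp : (μ.comp F).toAddMonoidHom = a • g := by
      rw [← hsum, ← hμ]; rfl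
    have h1 : ((μ.comp F).deg : ℤ) = a ^ 2 := by
      rw [← degHom_toAddMonoidHom, hcomp, hdega]
    rw [Isogeny.deg_comp, hF, deg_frobeniusTwistIsogeny, Nat.cast_mul] at h1
    have h2 : (p : ℤ) ∣ a ^ 2 := by
      obtain ⟨s, hs⟩ : ∃ s, r = s + 1 := ⟨r - 1, by omega⟩
      have hps : ((p ^ r : ℕ) : ℤ) = p * (p : ℤ) ^ s := by
        rw [hs, pow_succ]
        push_cast
        ring
      refine ⟨μ.deg * (p : ℤ) ^ s, ?_⟩
      rw [← h1, hps]
      ring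
    exact hpi.dvd_of_dvd_pow h2

end Trace

/-! ## §2 Deuring's criterion downstairs: a CM endomorphism `ψ² = D` over `𝔽_p` -/

section Quadratic

/-- **Coordinates of a quadratic integer over `{1, √D}`.** In a quadratic number field `k`
(`[k : ℚ] = 2`) containing `x` with `x² = D < 0`, an element `y` with `y² - ay + c = 0`
(`a, c ∈ ℤ`) is either a rational integer, or `y = (a + w x)/2` with `w ∈ ℚ`, `w ≠ 0`,
`w² D = a² - 4c`: write `y = u + vx` with `u, v ∈ ℚ` (`1, x` is a `ℚ`-basis, `x ∉ ℚ` because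
`D < 0`) and compare coefficients; if `v = 0` the rational root `u` of the monic integer polynomial
`X² - aX + c` is an integer (Mathlib's integral root theorem). [folklore] -/
theorem eq_intCast_or_exists_sq_mul_eq_of_finrank_eq_two {k : Type*} [Field k] [NumberField k]
    (h2 : Module.finrank ℚ k = 2) {x y : k} {D a c : ℤ} (hD : D < 0) (hx : x * x = D)
    (hy : y * y - a * y + c = 0) :
    (∃ m : ℤ, y = m) ∨ ∃ w : ℚ, w ≠ 0 ∧ w ^ 2 * D = a ^ 2 - 4 * c := by
  -- `1, x` are linearly independent over `ℚ`
  have hlin : ∀ s t : ℚ, (s : k) + (t : k) * x = 0 → s = 0 ∧ t = 0 := by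
    intro s t hst
    by_cases ht : t = 0
    · subst ht
      rw [Rat.cast_zero, zero_mul, add_zero, Rat.cast_eq_zero] at hst
      exact ⟨hst, rfl⟩
    · exfalso
      have ht' : (t : k) ≠ 0 := by exact_mod_cast ht
      have hxst : x = ((-s / t : ℚ) : k) := by
        push_cast
        field_simp
        linear_combination hst
      have h1 : (((-s / t) ^ 2 : ℚ) : k) = ((D : ℚ) : k) := by
        rw [Rat.cast_pow, ← hxst, sq, hx, Rat.cast_intCast]
      have h2' : (-s / t) ^ 2 = (D : ℚ) := by exact_mod_cast h1
      have h3 : (D : ℚ) < 0 := by exact_mod_cast hD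
      nlinarith [sq_nonneg (-s / t)]
  -- `y = u + v x` with `u, v ∈ ℚ`
  have hdep : ¬ LinearIndependent ℚ ![(1 : k), x, y] := fun hli ↦ by
    have := hli.fintype_card_le_finrank
    rw [Fintype.card_fin, h2] at this
    omega
  obtain ⟨g, hg, i, hi⟩ := Fintype.not_linearIndependent_iff.mp hdep
  simp only [Fin.sum_univ_three, Matrix.cons_val_zero, Matrix.cons_val_one, Matrix.cons_val_two,
    Matrix.head_cons, Matrix.tail_cons, Algebra.smul_def, eq_ratCast, mul_one] at hg
  by_cases hg2 : g 2 = 0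
  · exfalso
    rw [hg2, Rat.cast_zero, zero_mul, add_zero] at hg
    obtain ⟨h0, h1⟩ := hlin _ _ hg
    refine hi ?_
    fin_cases i
    · exact h0
    · exact h1
    · exact hg2
  set u : ℚ := -g 0 / g 2 with hu
  set v : ℚ := -g 1 / g 2 with hv
  have hg2' : ((g 2 : ℚ) : k) ≠ 0 := by exact_mod_cast hg2
  have hyuv : y = (u : k) + (v : k) * x := by
    rw [hu, hv]
    push_cast
    field_simp
    linear_combination hg
  -- compare coefficients in `y² - ay + c = 0`
  have hcoef : ((u ^ 2 + v ^ 2 * D - a * u + c : ℚ) : k) + ((2 * u * v - a * v : ℚ) : k) * x = 0 := by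
    push_cast
    rw [hyuv] at hy
    linear_combination hy - (v : k) ^ 2 * hx
  obtain ⟨hc1, hc2⟩ := hlin _ _ hcoef
  by_cases hv0 : v = 0
  · -- `y = u` is a rational root of `X² - aX + c`, hence an integer
    left
    rw [hv0] at hc1 hyuv
    simp only [zero_pow two_ne_zero, zero_mul, add_zero, Rat.cast_zero] at hc1 hyuv
    have hmonic : (Polynomial.X ^ 2 - Polynomial.C a * Polynomial.X + Polynomial.C c : Polynomial ℤ).Monic := by
      monicity!
    have hroot : Polynomial.aeval u
        (Polynomial.X ^ 2 - Polynomial.C a * Polynomial.X + Polynomial.C c : Polynomial ℤ) = 0 := by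
      simp only [map_add, map_sub, map_mul, map_pow, Polynomial.aeval_X, eq_intCast, map_intCast]
      linear_combination hc1
    obtain ⟨m, hm, -⟩ := exists_integer_of_is_root_of_monic hmonic hroot
    refine ⟨m, ?_⟩
    rw [hyuv, hm, algebraMap_int_eq, eq_intCast, Rat.cast_intCast]
  · right
    refine ⟨2 * v, mul_ne_zero two_ne_zero hv0, ?_⟩
    have hu2 : 2 * u - a = 0 := by
      have : v * (2 * u - a) = 0 := by linear_combination hc2
      rcases mul_eq_zero.mp this with h | h
      · exact (hv0 h).elim
      · exact h
    linear_combination 4 * hc1 - (2 * u - a) * hu2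

variable (W : WeierstrassCurve K) [W.IsElliptic] (p : ℕ) [Fact p.Prime] [CharP K p]

/-- **Deuring's criterion, split case, from a geometric endomorphism `ψ` with `ψ² = [D]`.** Let
`E = W` be an elliptic curve over a field `K` of odd characteristic `p` and `ψ ∈ End_{K̄}(E)`
(`W.geomEndRing`) with `ψ ∘ ψ = [D]` on `E(K̄)`, `D < 0`, `p ∤ D`, `D` a square modulo `p`
(`p` splits in `ℚ(√D)`). Then `E(K̄)` has a point of order `p` (`E` is ordinary). `ψ ≠ 0` is
algebraic (`mem_geomEndRing_iff_holds`); transported along `E(K̄) ≃ E_{K̄}(K̄̄)`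
(`IsAlgebraicOn.toIsogenyBaseChange`) it is an isogeny of `E_{K̄}` over `K̄` with `ψ ∘ ψ = [D]`, to
which the tree's `Isogeny.exists_ne_zero_nsmul_eq_zero_of_comp_self_eq_smul` (the
characteristic-`p` half of Lang, *Elliptic Functions*, Ch. 13 §4 Thm. 12, proof PDF
pp. 140–141) applies — exactly as in the tree's `exists_ne_zero_nsmul_eq_zero_of_cmEnd`.
[cite: Lang1987, Ch. 13 §4 Thm. 12 (first assertion, split case) and its proof (PDF pp. 140–141)] -/
theorem exists_ne_zero_nsmul_eq_zero_of_sq_eq_intCast (hp2 : p ≠ 2) {D : ℤ} (hD : D < 0)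
    (hpD : ¬ (p : ℤ) ∣ D) (hsq : IsSquare ((D : ℤ) : ZMod p))
    {ψ : AddMonoid.End W.geomPoints} (hψ : ψ ∈ W.geomEndRing)
    (hψψ : ψ * ψ = (D : AddMonoid.End W.geomPoints)) :
    ∃ P : W.geomPoints, P ≠ 0 ∧ p • P = 0 := by
  have hψQ : ∀ Q : W.geomPoints, ψ (ψ Q) = D • Q := fun Q ↦ by
    have h := congrArg (fun f : AddMonoid.End W.geomPoints ↦ f Q) hψψ
    exact h
  rcases (mem_geomEndRing_iff_holds W ψ).mp hψ with h0 | halg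
  · exfalso
    haveI := charZero_geomEndRing W
    have hd0 : ((D : ℤ) : W.geomEndRing) = 0 := by
      apply Subtype.ext
      rw [SubringClass.coe_intCast, ZeroMemClass.coe_zero, ← hψψ, h0, mul_zero]
    exact hD.ne (Int.cast_eq_zero.mp hd0)
  · have hΨ : ∀ Q, halg.toIsogenyBaseChange (halg.toIsogenyBaseChange Q) = D • Q := fun Q ↦ by
      rw [IsAlgebraicOn.toIsogenyBaseChange_apply, IsAlgebraicOn.toIsogenyBaseChange_apply,
        AddEquiv.symm_apply_apply]
      change W.geomPointsBaseChangeEquiv (ψ (ψ (W.geomPointsBaseChangeEquiv.symm Q))) = D • Q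
      rw [hψQ, map_zsmul, AddEquiv.apply_symm_apply]
    obtain ⟨Q, hQ0, hQp⟩ := Isogeny.exists_ne_zero_nsmul_eq_zero_of_comp_self_eq_smul p hp2
      halg.toIsogenyBaseChange hΨ hD hpD hsq
    refine ⟨W.geomPointsBaseChangeEquiv.symm Q, fun h ↦ hQ0 ?_, ?_⟩
    · rw [← AddEquiv.apply_symm_apply W.geomPointsBaseChangeEquiv Q, h, map_zero]
    · rw [← map_nsmul, hQp, map_zero]

end Quadratic

section PrimeField

variable {p : ℕ} [Fact p.Prime] (V : WeierstrassCurve (ZMod p)) [V.IsElliptic]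

/-- **An ordinary curve with a geometric endomorphism `ψ² = [D]` and `p ∤ a` has `(D/p) = 1`**
(the mechanism of the inert half of Deuring's criterion, Lang, *Elliptic Functions*, Ch. 13 §4
Thm. 12, PDF pp. 140–141). Let `E = V` be an elliptic curve over `𝔽_p` with a geometric point of
order `p`, `a = p + 1 - #E(𝔽_p)` with `p ∤ a`, and `ψ ∈ End_{𝔽̄_p}(E)` with `ψ² = [D]`, `D < 0`.
By Deuring's theorem (Lang Ch. 13 §2 Thm. 5(i); the tree's
`Lang1987_geomEndRing_isOrder_of_exists_pTorsion_holds`) `End_{𝔽̄_p}(E)` embeds, by an injective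
ring homomorphism `e`, into the integers of an imaginary quadratic field `k`; there `e(ψ)² = D`,
so `k = ℚ(√D)`, and the Frobenius `π` (`π² - aπ + p = 0`, *AEC* V.2.3.1(b)) maps to
`(a + w√D)/2` with `w ∈ ℚ`, `w² D = a² - 4p` (`eq_intCast_or_exists_sq_mul_eq_of_finrank_eq_two`;
the alternative `e(π) ∈ ℤ` is excluded by Lang's Thm. 4, the tree's `frobeniusIsogeny_ne_intCast`).
Writing `w = N/M` in lowest terms, `N² D ≡ M² a² (mod p)` with `p ∤ N` (else `p ∣ M` or
`p ∣ a`), so `D` is a square modulo `p`. [cite: Lang1987, Ch. 13 §4 Thm. 12 (proof, PDF pp. 140–141) and §2 Thm. 4, Thm. 5(i)] -/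
theorem isSquare_of_exists_nsmul_eq_zero_of_not_dvd_trace
    (hT : ∃ P : V.geomPoints, P ≠ 0 ∧ p • P = 0)
    (ha : ¬ (p : ℤ) ∣ (p : ℤ) + 1 - Nat.card V.toAffine.Point) {D : ℤ} (hD : D < 0)
    {ψ : AddMonoid.End V.geomPoints} (hψ : ψ ∈ V.geomEndRing)
    (hψψ : ψ * ψ = (D : AddMonoid.End V.geomPoints)) :
    IsSquare ((D : ℤ) : ZMod p) := by
  have hp : p.Prime := Fact.out
  obtain ⟨σ, hσ⟩ := WeierstrassCurve.exists_frobenius_absoluteGaloisGroup (ZMod p)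
  have hq : Nat.card (ZMod p) = p := Nat.card_zmod p
  have hT' : ∃ P : V.geomPoints, P ≠ 0 ∧ ringChar (ZMod p) • P = 0 := by
    rwa [ZMod.ringChar_zmod_n]
  obtain ⟨k, _, _, ⟨hk2, -⟩, e, he, -⟩ := Lang1987_geomEndRing_isOrder_of_exists_pTorsion_holds V hT'
  set a : ℤ := (p : ℤ) + 1 - Nat.card V.toAffine.Point with ha_def
  -- the elements `ψ` and `π` of `End_{𝔽̄_p}(V)`
  set ψe : V.geomEndRing := ⟨ψ, hψ⟩ with hψe_def
  set πe : V.geomEndRing := ⟨(V.frobeniusIsogeny hσ).toAddMonoidHom,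
    V.endRing_le_geomEndRing (V.frobeniusIsogeny hσ).toAddMonoidHom_mem_endRing⟩ with hπe_def
  have hψrel : ψe * ψe = (D : V.geomEndRing) := by
    apply Subtype.ext
    push_cast
    exact hψψ
  have hπrel : πe * πe - (a : V.geomEndRing) * πe + (p : V.geomEndRing) = 0 := by
    apply Subtype.ext
    refine AddMonoidHom.ext fun P ↦ ?_
    have hP := V.frobenius_frobenius_sub_trace_smul_add_card_smul hσ P
    rw [hq] at hP
    change σ • (σ • P) - (a : AddMonoid.End V.geomPoints) (σ • P) +
      ((p : ℕ) : AddMonoid.End V.geomPoints) P = 0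
    rw [AddMonoid.End.intCast_apply, AddMonoid.End.natCast_apply, ← natCast_zsmul P p]
    exact hP
  -- in the field `k`
  set x : k := algebraMap (𝓞 k) k (e ψe) with hx_def
  set y : k := algebraMap (𝓞 k) k (e πe) with hy_def
  have hx : x * x = D := by
    have h := congrArg (fun z : V.geomEndRing ↦ algebraMap (𝓞 k) k (e z)) hψrel
    simpa using h
  have hy : y * y - a * y + ((p : ℤ) : k) = 0 := by
    have h := congrArg (fun z : V.geomEndRing ↦ algebraMap (𝓞 k) k (e z)) hπrel
    simpa using h
  rcases eq_intCast_or_exists_sq_mul_eq_of_finrank_eq_two hk2 hD hx hy with ⟨m, hm⟩ | ⟨w, hw0, hw⟩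
  · -- `π = [m]` is impossible (Lang, Thm. 4)
    exfalso
    have h1 : e πe = (m : 𝓞 k) := by
      apply NumberField.RingOfIntegers.coe_injective
      rw [map_intCast]
      exact hm
    have h2 : πe = (m : V.geomEndRing) := he (by rw [h1, map_intCast])
    have h3 := congrArg Subtype.val h2
    simp only [hπe_def, SubringClass.coe_intCast] at h3
    exact frobeniusIsogeny_ne_intCast V hσ hT' m h3
  · -- `w = N/M`, `N² D = M² (a² - 4p)`, so `D ≡ (Ma/N)² (mod p)`
    have hM0 : (w.den : ℚ) ≠ 0 := by exact_mod_cast w.den_ne_zero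
    have hNM : (w.num : ℚ) ^ 2 * D = (w.den : ℚ) ^ 2 * (a ^ 2 - 4 * p) := by
      have hw' : (w : ℚ) = w.num / w.den := (Rat.num_div_den w).symm
      rw [hw'] at hw
      field_simp at hw
      linear_combination hw
    have hint : w.num ^ 2 * D = (w.den : ℤ) ^ 2 * (a ^ 2 - 4 * p) := by exact_mod_cast hNM
    have hmod : ((w.num : ZMod p)) ^ 2 * (D : ZMod p) = ((w.den : ZMod p)) ^ 2 * (a : ZMod p) ^ 2 := by
      have h := congrArg (Int.cast : ℤ → ZMod p) hint
      push_cast at h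
      rw [h, ZMod.natCast_self]
      ring
    have hN0 : (w.num : ZMod p) ≠ 0 := by
      intro hN
      rw [hN, zero_pow two_ne_zero, zero_mul, eq_comm, mul_eq_zero] at hmod
      rcases hmod with hM | ha0
      · have hpM : p ∣ w.den := (ZMod.natCast_eq_zero_iff w.den p).mp (pow_eq_zero_iff two_ne_zero |>.mp hM)
        have hpN : p ∣ w.num.natAbs :=
          Int.natCast_dvd.mp ((ZMod.intCast_zmod_eq_zero_iff_dvd w.num p).mp hN)
        have h1 : p ∣ Nat.gcd w.num.natAbs w.den := Nat.dvd_gcd hpN hpM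
        rw [w.reduced] at h1
        exact hp.one_lt.ne' (Nat.dvd_one.mp h1)
      · exact ha ((ZMod.intCast_zmod_eq_zero_iff_dvd a p).mp (pow_eq_zero_iff two_ne_zero |>.mp ha0))
    refine ⟨(w.den : ZMod p) * a / w.num, ?_⟩
    field_simp
    linear_combination hmod

/-- **Deuring's criterion over `𝔽_p` for a curve with a geometric endomorphism `ψ² = [D]`**:
for `p` odd, `D < 0`, `p ∤ D`, an elliptic curve `E/𝔽_p` with `ψ ∈ End_{𝔽̄_p}(E)`, `ψ² = [D]`
is supersingular (`p ∣ a_p`, `a_p = p + 1 - #E(𝔽_p)`) iff `D` is a non-square modulo `p` (`p`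
inert in `ℚ(√D)`). (⇒) if `D` were a square, `E` would have a point of order `p`
(`exists_ne_zero_nsmul_eq_zero_of_sq_eq_intCast`), contradicting `p ∣ a`
(`forall_nsmul_ne_zero_of_dvd_trace`); (⇐) if `p ∤ a` then `E` has a point of order `p`
(`dvd_trace_of_forall_nsmul_ne_zero`) and `D` is a square
(`isSquare_of_exists_nsmul_eq_zero_of_not_dvd_trace`). Lang, *Elliptic Functions*, Ch. 13 §4
Thm. 12 (first assertion). [cite: Lang1987, Ch. 13 §4 Thm. 12 (PDF p. 140)] [cite: Deuring1941] -/
theorem natCast_dvd_trace_iff_not_isSquare (hp2 : p ≠ 2) {D : ℤ} (hD : D < 0)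
    (hpD : ¬ (p : ℤ) ∣ D) {ψ : AddMonoid.End V.geomPoints} (hψ : ψ ∈ V.geomEndRing)
    (hψψ : ψ * ψ = (D : AddMonoid.End V.geomPoints)) :
    (p : ℤ) ∣ (p : ℤ) + 1 - Nat.card V.toAffine.Point ↔ ¬ IsSquare ((D : ℤ) : ZMod p) := by
  obtain ⟨σ, hσ⟩ := WeierstrassCurve.exists_frobenius_absoluteGaloisGroup (ZMod p)
  have hq : Nat.card (ZMod p) = p := Nat.card_zmod p
  constructor
  · intro ha hsq
    obtain ⟨P, hP0, hpP⟩ := V.exists_ne_zero_nsmul_eq_zero_of_sq_eq_intCast p hp2 hD hpD hsq hψ hψψ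
    have ha' : (p : ℤ) ∣ (Nat.card (ZMod p) : ℤ) + 1 - Nat.card V.toAffine.Point := by rwa [hq]
    exact V.forall_nsmul_ne_zero_of_dvd_trace p hσ ha' P hP0 hpP
  · intro hsq
    by_contra ha
    have hT : ∃ P : V.geomPoints, P ≠ 0 ∧ p • P = 0 := by
      by_contra hT
      have h := V.dvd_trace_of_forall_nsmul_ne_zero p hσ (fun P hP h0 ↦ hT ⟨P, hP, h0⟩)
      rw [hq] at h
      exact ha h
    exact hsq (V.isSquare_of_exists_nsmul_eq_zero_of_not_dvd_trace hT ha hD hψ hψψ)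

end PrimeField

/-! ## §3 Upstairs: a CM curve over `ℚ` -/

section CM

variable (W : WeierstrassCurve K) [W.IsElliptic]

/-- **A CM curve carries a geometric endomorphism `ψ` with `ψ² = [D]`, `D < 0`.** If
`End_{K̄}(E) ≠ ℤ`, pick `φ ∈ End_{K̄}(E) ∖ ℤ`; by Silverman, *AEC*, Cor. III.6.3 (the tree's
`exists_int_quadratic_of_mem_geomEndRing`: `deg` is a positive definite quadratic form)
`φ² - tφ + n = 0` with `m² + tmn' + nn'² > 0` whenever `m + n'φ ≠ 0`; then `ψ = 2φ - t` satisfies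
`ψ² = t² - 4n =: D`, and `D < 0` (the form at `(m, n') = (-t, 2)`, where `ψ ≠ 0` because
`End_{K̄}(E)` is a domain of characteristic `0` and `φ ∉ ℤ`). This `D` is the discriminant of
`ℤ[φ]`, and `ℚ(√D)` the CM field. [cite: SilvermanAEC2009, Cor. III.6.3 and Cor. III.9.4] -/
theorem exists_sq_eq_intCast_of_hasCM (h : W.HasCM) :
    ∃ ψ ∈ W.geomEndRing, ∃ D : ℤ, D < 0 ∧ ψ * ψ = (D : AddMonoid.End W.geomPoints) := by
  obtain ⟨φ, hφ, hφne⟩ := h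
  obtain ⟨t, n, hrel, hpos⟩ := WeierstrassCurve.exists_int_quadratic_of_mem_geomEndRing W hφ
  haveI := charZero_geomEndRing W
  haveI := isDomain_geomEndRing W
  set ψ : AddMonoid.End W.geomPoints := 2 * φ - (t : AddMonoid.End W.geomPoints) with hψ_def
  have hψmem : ψ ∈ W.geomEndRing :=
    sub_mem (mul_mem (natCast_mem W.geomEndRing 2) hφ) (intCast_mem W.geomEndRing t)
  -- `φ (φ Q) = t φ Q - n Q`, `ψ (ψ Q) = (t² - 4n) Q`
  have hφQ : ∀ Q : W.geomPoints, φ (φ Q) = t • φ Q - n • Q := fun Q ↦ by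
    have h := congrArg (fun f : AddMonoid.End W.geomPoints ↦ f Q) hrel
    change φ (φ Q) - t • φ Q + n • Q = 0 at h
    rw [← sub_eq_zero, ← h]
    abel
  have hψQ : ∀ Q : W.geomPoints, ψ Q = 2 • φ Q - t • Q := fun Q ↦ rfl
  have hψψQ : ∀ Q : W.geomPoints, ψ (ψ Q) = (t ^ 2 - 4 * n) • Q := fun Q ↦ by
    rw [hψQ Q, map_sub, map_nsmul, map_zsmul, hψQ (φ Q), hψQ Q, hφQ]
    module
  have hψψ : ψ * ψ = ((t ^ 2 - 4 * n : ℤ) : AddMonoid.End W.geomPoints) :=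
    AddMonoidHom.ext fun Q ↦ hψψQ Q
  refine ⟨ψ, hψmem, t ^ 2 - 4 * n, ?_, hψψ⟩
  -- `ψ ≠ 0`: otherwise `2φ = t` in the domain `End_{K̄}(E)` of characteristic `0`, forcing `φ ∈ ℤ`
  have hψ0 : ψ ≠ 0 := by
    intro h0
    rw [hψ_def, sub_eq_zero] at h0
    obtain ⟨φe, hφe⟩ : ∃ φe : W.geomEndRing, (φe : AddMonoid.End W.geomPoints) = φ := ⟨⟨φ, hφ⟩, rfl⟩
    have h2φ : (2 : W.geomEndRing) * φe = (t : W.geomEndRing) := by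
      apply Subtype.ext
      push_cast
      rw [hφe]
      exact h0
    have hrel' : φe * φe - (t : W.geomEndRing) * φe + (n : W.geomEndRing) = 0 := by
      apply Subtype.ext
      push_cast
      rw [hφe]
      exact hrel
    have key : (4 : W.geomEndRing) * (φe * φe - (t : W.geomEndRing) * φe + (n : W.geomEndRing)) =
        (2 * φe) * (2 * φe) - 2 * ((t : W.geomEndRing) * (2 * φe)) + 4 * (n : W.geomEndRing) := by
      noncomm_ring
    rw [hrel', mul_zero, h2φ] at key
    have ht2 : t ^ 2 = 4 * n := by
      have h4 : ((t ^ 2 - 4 * n : ℤ) : W.geomEndRing) = 0 := by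
        push_cast
        rw [show (t : W.geomEndRing) ^ 2 - 4 * (n : W.geomEndRing) =
          -((t : W.geomEndRing) * t - 2 * ((t : W.geomEndRing) * t) + 4 * n) by noncomm_ring, ← key,
          neg_zero]
      have := Int.cast_eq_zero.mp h4
      linarith
    have hteven : (2 : ℤ) ∣ t := by
      have : (2 : ℤ) ∣ t ^ 2 := ⟨2 * n, by rw [ht2]; ring⟩
      exact Int.prime_two.dvd_of_dvd_pow this
    obtain ⟨t', ht'⟩ := hteven
    have hφt : φe = (t' : W.geomEndRing) := by
      have : (2 : W.geomEndRing) * φe = 2 * (t' : W.geomEndRing) := by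
        rw [h2φ, ht', Int.cast_mul, Int.cast_ofNat]
      exact mul_left_cancel₀ two_ne_zero this
    apply hφne t'
    have := congrArg Subtype.val hφt
    rw [hφe] at this
    simpa using this
  have h1 : ((-t : ℤ) : AddMonoid.End W.geomPoints) + ((2 : ℤ) : AddMonoid.End W.geomPoints) * φ ≠ 0 := by
    intro h0
    apply hψ0
    calc ψ = ((-t : ℤ) : AddMonoid.End W.geomPoints) + ((2 : ℤ) : AddMonoid.End W.geomPoints) * φ := by
          rw [hψ_def]
          push_cast
          abel
      _ = 0 := h0
  have h2 := hpos (-t) 2 h1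
  nlinarith

end CM

end WeierstrassCurve

/-! ## §3 (continued) The criterion for the good supersingular primes of a CM curve over `ℚ` -/

namespace Literature.NumberTheory.EllipticCurves

open WeierstrassCurve

/-- `a_p(W) = p + 1 - #Ē(𝔽_p)` for the reduction `Ē = reductionModPrime W p` (by definition of
`frobeniusTrace` and `reductionPointCount`). [folklore] -/
theorem frobeniusTrace_eq_sub_natCard_reductionModPrime (W : WeierstrassCurve ℚ)
    [W.IsGloballyMinimal] (p : ℕ) :
    W.frobeniusTrace p = (p : ℤ) + 1 - Nat.card (reductionModPrime W p).toAffine.Point := by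
  rw [frobeniusTrace, reductionPointCount_eq_natCard_point]

/-- **Deuring's criterion for `E/ℚ` at a good prime, from the reduction of endomorphisms.**
Assume the named fact `Silverman1994_exists_reduction_ringHom_geomEndRing` (Silverman, *Advanced
Topics*, Prop. II.4.4: reduction of endomorphisms modulo a good prime is a ring homomorphism
`r : End_{ℚ̄}(E) → End_{𝔽̄_p}(Ē)`). Let `W/ℚ` be a globally minimal elliptic curve carrying
`ψ ∈ End_{ℚ̄}(E)` with `ψ² = [D]`, `D < 0` (complex multiplication by `ℚ(√D)`), and let `p` be a
prime with `p ∤ 2DΔ_W`. Then `p ∣ a_p(W)` (supersingular reduction) iff `D` is a non-square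
modulo `p` (`p` inert in `ℚ(√D)`): `r(ψ)² = [D]` on the elliptic curve `Ē = reductionModPrime W p`
over `𝔽_p`, to which `natCast_dvd_trace_iff_not_isSquare` applies. Lang, *Elliptic Functions*,
Ch. 13 §4 Thm. 12; Deuring 1941. [cite: Lang1987, Ch. 13 §4 Thm. 12 (PDF p. 140)]
[cite: SilvermanAdvancedTopics1994, Prop. II.4.4] [cite: Deuring1941] -/
theorem natCast_dvd_frobeniusTrace_iff_not_isSquare_of_reduction
    (hR : Silverman1994_exists_reduction_ringHom_geomEndRing)
    (W : WeierstrassCurve ℚ) [W.IsElliptic] [W.IsGloballyMinimal]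
    {ψ : AddMonoid.End W.geomPoints} (hψ : ψ ∈ W.geomEndRing) {D : ℤ} (hD : D < 0)
    (hψψ : ψ * ψ = (D : AddMonoid.End W.geomPoints)) (p : ℕ) [Fact p.Prime] (hp2 : p ≠ 2)
    (hpD : ¬ (p : ℤ) ∣ D) (hΔ : ¬ (p : ℤ) ∣ minimalDiscriminantInt W) :
    (p : ℤ) ∣ W.frobeniusTrace p ↔ ¬ IsSquare ((D : ℤ) : ZMod p) := by
  haveI : (reductionModPrime W p).IsElliptic := isElliptic_reductionModPrime W hΔ
  obtain ⟨r, -, -⟩ := hR W p hΔ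
  set ψr : (reductionModPrime W p).geomEndRing := r ⟨ψ, hψ⟩ with hψr_def
  have hψr : (ψr : AddMonoid.End (reductionModPrime W p).geomPoints) * ψr =
      (D : AddMonoid.End (reductionModPrime W p).geomPoints) := by
    have h1 : (⟨ψ, hψ⟩ : W.geomEndRing) * ⟨ψ, hψ⟩ = (D : W.geomEndRing) := Subtype.ext (by
      push_cast; exact hψψ)
    have h2 : ψr * ψr = (D : (reductionModPrime W p).geomEndRing) := by
      rw [hψr_def, ← map_mul, h1, map_intCast]
    have h3 := congrArg Subtype.val h2
    simpa using h3
  rw [frobeniusTrace_eq_sub_natCard_reductionModPrime]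
  exact (reductionModPrime W p).natCast_dvd_trace_iff_not_isSquare hp2 hD hpD ψr.2 hψr

/-- **The good supersingular primes of a CM curve over `ℚ` are, up to finitely many, the primes
inert in the CM field** — from the reduction of endomorphisms. Assume the named fact
`Silverman1994_exists_reduction_ringHom_geomEndRing` (Silverman, *Advanced Topics*,
Prop. II.4.4). For every elliptic curve `E/ℚ`, given by a globally minimal `W`, with (geometric)
complex multiplication there are `D < 0` (`ψ² = [D]` for a geometric endomorphism `ψ`,
`exists_sq_eq_intCast_of_hasCM`; `ℚ(√D)` is the CM field) and `N` such that for every prime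
`p ≥ N`: `p ∈ goodSupersingularPrimes W` (good reduction and `p ∣ a_p`) iff `(D/p) = -1`. Here
`N = |2DΔ_W| + 1`: for `p ∤ 2DΔ_W` the reduction is good (`hasGoodReductionAtPrime_of_not_dvd`)
and Deuring's criterion `natCast_dvd_frobeniusTrace_iff_not_isSquare_of_reduction` applies.
Lang, *Elliptic Functions*, Ch. 13 §4 Thm. 12 (*"The curve `Ā` is supersingular if and only if
`p` has only one prime of `k` above it"*); Deuring 1941; this is the arithmetic input of the
density statement `WeierstrassCurve.deuring_supersingular_density_half` (Serre 1981, §7.2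
Rem. 3, §8). [cite: Lang1987, Ch. 13 §4 Thm. 12 (PDF p. 140)] [cite: Deuring1941]
[cite: SilvermanAdvancedTopics1994, Prop. II.4.4] -/
theorem exists_forall_mem_goodSupersingularPrimes_iff_of_reduction
    (hR : Silverman1994_exists_reduction_ringHom_geomEndRing)
    (W : WeierstrassCurve ℚ) [W.IsElliptic] [W.IsGloballyMinimal] (hCM : W.HasCM) :
    ∃ D : ℤ, D < 0 ∧ ∃ N : ℕ, ∀ p : ℕ, N ≤ p → p.Prime →
      (p ∈ W.goodSupersingularPrimes ↔ J(D | p) = -1) := by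
  obtain ⟨ψ, hψ, D, hD, hψψ⟩ := W.exists_sq_eq_intCast_of_hasCM hCM
  have hΔ0 : minimalDiscriminantInt W ≠ 0 := minimalDiscriminantInt_ne_zero W
  refine ⟨D, hD, (2 * D * minimalDiscriminantInt W).natAbs + 1, fun p hp hprime ↦ ?_⟩
  haveI : Fact p.Prime := ⟨hprime⟩
  have hpi : Prime (p : ℤ) := Nat.prime_iff_prime_int.mp hprime
  -- `p ∤ 2 D Δ`
  have hndvd : ¬ (p : ℤ) ∣ 2 * D * minimalDiscriminantInt W := fun h ↦ by
    have h0 : 2 * D * minimalDiscriminantInt W ≠ 0 :=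
      mul_ne_zero (mul_ne_zero two_ne_zero hD.ne) hΔ0
    have h1 : p ≤ (2 * D * minimalDiscriminantInt W).natAbs :=
      Nat.le_of_dvd (Int.natAbs_pos.mpr h0) (Int.natCast_dvd.mp h)
    omega
  have hp2 : p ≠ 2 := by
    rintro rfl
    exact hndvd (dvd_mul_of_dvd_left (dvd_mul_right _ _) _)
  have hpD : ¬ (p : ℤ) ∣ D := fun h ↦ hndvd (dvd_mul_of_dvd_left (dvd_mul_of_dvd_right h _) _)
  have hpΔ : ¬ (p : ℤ) ∣ minimalDiscriminantInt W := fun h ↦ hndvd (dvd_mul_of_dvd_right h _)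
  have hgood : W.HasGoodReductionAtPrime p := hasGoodReductionAtPrime_of_not_dvd W p hpΔ
  rw [ZMod.nonsquare_iff_jacobiSym_eq_neg_one,
    ← natCast_dvd_frobeniusTrace_iff_not_isSquare_of_reduction hR W hψ hD hψψ p hp2 hpD hpΔ]
  constructor
  · rintro ⟨_, -, h⟩
    exact h
  · intro h
    exact ⟨⟨hprime⟩, hgood, h⟩

/-- The same, from the existence of the reduction map on points and endomorphisms (the named fact
`Lang1987_exists_reduction_geomPoints_geomEndRing`, Lang, *Elliptic Functions*, Ch. 9 §1–2 and
Ch. 13 §4; Silverman, *Advanced Topics*, Prop. II.4.4), through the tree's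
`Silverman1994_exists_reduction_ringHom_geomEndRing_of_exists_reduction`.
[cite: Lang1987, Ch. 13 §4 Thm. 12 (PDF p. 140) and Ch. 9 §2 (PDF pp. 83–84)] -/
theorem exists_forall_mem_goodSupersingularPrimes_iff_of_exists_reduction
    (hR₀ : Lang1987_exists_reduction_geomPoints_geomEndRing)
    (W : WeierstrassCurve ℚ) [W.IsElliptic] [W.IsGloballyMinimal] (hCM : W.HasCM) :
    ∃ D : ℤ, D < 0 ∧ ∃ N : ℕ, ∀ p : ℕ, N ≤ p → p.Prime →
      (p ∈ W.goodSupersingularPrimes ↔ J(D | p) = -1) :=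
  exists_forall_mem_goodSupersingularPrimes_iff_of_reduction
    (Silverman1994_exists_reduction_ringHom_geomEndRing_of_exists_reduction hR₀) W hCM

end Literature.NumberTheory.EllipticCurves
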